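import Mathlib.GroupTheory.GroupAction.Period
import Mathlib.Algebra.Group.Conj
import Mathlib.Algebra.Group.Action.End
import Literature.Topology.FourManifolds.KhResolutions
import HarnessLib

/-!
# Merge, split, or single-circle bifurcation: the combinatorial trichotomy

Topic: Topology / FourManifolds (companion "Proofs" file to `KhResolutions.lean`, the complete
resolutions of a Gauss diagram `G : GaussDiagram` à la Viro).

`KhResolutions` defines, for a state `σ` and a `0`-smoothed chord `i`, the predicates
`IsMergeAt σ i` / `IsSplitAt σ i` (the flip `0 → 1` at `i` joins two state circles / splits one)
and vendors the named fact `isMergeAt_or_isSplitAt_of_hasGaussDiagram`: for a Gauss diagram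
realised by a knot every flip is a merge or a split (Viro (2004), §5.2, p. 330: the Morse
modification relating the two resolutions *is embedded in the plane*, hence oriented, hence
`|S| - |T| = ±1`). For abstract (virtual) Gauss diagrams a third case occurs, the
*single-circle* (one-to-one) bifurcation (Viro (2004), §5; Manturov, Izv. Math. 71 (2007)).

This file proves the **combinatorial half** of that fact, i.e. the purely diagrammatic
trichotomy behind Viro's sentence, with no planarity hypothesis:

* `eraseGlue σ i`, `eraseGraph σ i`: the resolution of `σ` at all chords *except* `i`, the
  crossing `i` being erased (both strands pass straight through it) — the 1-manifold on which
  the Morse modification at `i` is performed;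
* `restGlue σ i`, `strandPerm σ i` (`ρ = restGlue ∘ endFlip` on arc-ends), `strand σ i e₀`
  (the `ρ`-orbit of an end `e₀` at chord `i`) and `farEnd σ i e₀ = ρ^(m/2) e₀`: walking along
  the erased resolution from the end `e₀` one reaches chord `i` again for the first time at
  `farEnd σ i e₀`; algebraically, conjugation by the fixed-point-free involution `endFlip`
  inverts `ρ`, so the period `m` of `e₀` is even and the ends at chord `i` on the strand of `e₀`
  are exactly `e₀` and `ρ^(m/2) e₀` (`eq_self_or_eq_farEnd`);
* the trichotomy: for `e₀ = (overPos i, out)`, `farEnd = (underPos i, in)` forces the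
  Seifert-glued state at `i` to separate the two local strands, `farEnd = (underPos i, out)`
  forces the other state to, and `farEnd = (overPos i, in)` is the single-circle bifurcation,
  in which the two passages of chord `i` lie on *different* circles of the erased resolution
  (`not_reachable_eraseGraph_of_farEnd_eq`);
* `isMergeAt_or_isSplitAt_of_reachable_eraseGraph`: consequently, **if the over- and the
  under-strand of chord `i` lie on one circle of the erased resolution, the flip at `i` is a
  merge or a split.** What realisability by a knot must supply is exactly this hypothesis
  (two distinct circles of a planar resolution cannot cross transversally exactly once); that
  topological half is *not* proved here.

## Sources

* O. Viro, *Khovanov homology, its definitions and ramifications*, Fund. Math. 184 (2004)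
  317–342, §5.2 (p. 330). [cite: Viro2004]
* V. O. Manturov, *Khovanov homology for virtual knots with arbitrary coefficients*,
  Izv. Math. 71 (2007) 967–999 (single-circle bifurcations of virtual diagrams).
* Mathlib: `Function.Involutive.toPerm`, `conj_zpow`, `MulAction.period`
  (`MulAction.zpow_smul_eq_iff_period_dvd`, `MulAction.pow_smul_ne_of_lt_period`),
  `SimpleGraph.fromRel`, `SimpleGraph.Walk` induction.

## Design choices

* Everything is stated for an abstract `GaussDiagram` (no realisability), in
  `namespace Literature.Topology.FourManifolds.GaussDiagram` with `(G : GaussDiagram)` explicit,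
  as in `KhResolutions`.
* Boundary walks are handled algebraically (dihedral group generated by the two involutions
  `endFlip`, `restGlue σ i` on the finite set of arc-ends) rather than as lists; the bridge to
  the arc graphs of `KhResolutions` is `endArc_eq_endArc_iff` (an arc has exactly its two ends)
  and closure of the arc set of a strand under the relevant adjacency (`mem_of_reachable`).
* No new named fact is introduced (D-0026); the realisability half of
  `isMergeAt_or_isSplitAt_of_hasGaussDiagram` remains open and is isolated as the hypothesis
  of `isMergeAt_or_isSplitAt_of_reachable_eraseGraph`.
-/

open Function Set

noncomputable section

namespace Literature.Topology.FourManifolds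

namespace GaussDiagram

variable (G : GaussDiagram)

/-! ## Ends at a chord; the erased and the rest gluing -/

/-- The arc-end `e = (p, b)` **lies at chord `i`**: its marked point `p` is one of the two
passages `overPos i`, `underPos i` of chord `i`. [folklore] -/
def IsEndAt (i : Fin G.n) (e : Fin (2 * G.n) × Bool) : Prop :=
  e.1 = G.overPos i ∨ e.1 = G.underPos i

/-- Lying at chord `i` is decidable. [folklore] -/
instance (i : Fin G.n) : DecidablePred (G.IsEndAt i) := fun e ↦ by
  unfold IsEndAt; infer_instance

/-- The partner point of an end at chord `i` is again at chord `i`, and conversely. [folklore] -/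
theorem isEndAt_partner_iff (i : Fin G.n) (p : Fin (2 * G.n)) (b b' : Bool) :
    G.IsEndAt i (G.partner p, b) ↔ G.IsEndAt i (p, b') := by
  simp only [IsEndAt]
  constructor
  · rintro (h | h)
    · right; simpa using congrArg G.partner h
    · left; simpa using congrArg G.partner h
  · rintro (h | h)
    · right; simp [h]
    · left; simp [h]

/-- The gluing `endGlue` preserves lying at chord `i`. [folklore] -/
theorem isEndAt_endGlue_iff (σ : G.State) (i : Fin G.n) (e : Fin (2 * G.n) × Bool) :
    G.IsEndAt i (G.endGlue σ e) ↔ G.IsEndAt i e := by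
  obtain ⟨p, b⟩ := e
  exact G.isEndAt_partner_iff i p _ b

/-- The **erased gluing** at chord `i` in the state `σ`: ends away from chord `i` are glued by
the smoothings of `σ` (`endGlue`), while at the two passages of chord `i` the strands pass
straight through the erased crossing, `(p, in) ↔ (p, out)` for `p ∈ {overPos i, underPos i}`.
Its circles are those of the resolution of `σ` at all chords but `i`, the 1-manifold on which
the Morse modification at `i` acts (Viro (2004), §5.2, p. 330). [folklore] -/
def eraseGlue (σ : G.State) (i : Fin G.n) (e : Fin (2 * G.n) × Bool) : Fin (2 * G.n) × Bool :=
  if G.IsEndAt i e then (e.1, !e.2) else G.endGlue σ e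

/-- The **rest gluing** at chord `i` in the state `σ`: as `eraseGlue`, except that the four
ends at chord `i` are left unglued (fixed points). [folklore] -/
def restGlue (σ : G.State) (i : Fin G.n) (e : Fin (2 * G.n) × Bool) : Fin (2 * G.n) × Bool :=
  if G.IsEndAt i e then e else G.endGlue σ e

variable {G} in
/-- `eraseGlue` at an end of chord `i`. [folklore] -/
theorem eraseGlue_of_isEndAt {σ : G.State} {i : Fin G.n} {e : Fin (2 * G.n) × Bool}
    (h : G.IsEndAt i e) : G.eraseGlue σ i e = (e.1, !e.2) := if_pos h

variable {G} in
/-- `eraseGlue` away from chord `i` is the gluing of `σ`. [folklore] -/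
theorem eraseGlue_of_not_isEndAt {σ : G.State} {i : Fin G.n} {e : Fin (2 * G.n) × Bool}
    (h : ¬ G.IsEndAt i e) : G.eraseGlue σ i e = G.endGlue σ e := if_neg h

variable {G} in
/-- `restGlue` fixes the ends of chord `i`. [folklore] -/
theorem restGlue_of_isEndAt {σ : G.State} {i : Fin G.n} {e : Fin (2 * G.n) × Bool}
    (h : G.IsEndAt i e) : G.restGlue σ i e = e := if_pos h

variable {G} in
/-- `restGlue` away from chord `i` is the gluing of `σ`. [folklore] -/
theorem restGlue_of_not_isEndAt {σ : G.State} {i : Fin G.n} {e : Fin (2 * G.n) × Bool}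
    (h : ¬ G.IsEndAt i e) : G.restGlue σ i e = G.endGlue σ e := if_neg h

/-- `eraseGlue σ i` is an involution. [folklore] -/
@[simp]
theorem eraseGlue_eraseGlue (σ : G.State) (i : Fin G.n) (e : Fin (2 * G.n) × Bool) :
    G.eraseGlue σ i (G.eraseGlue σ i e) = e := by
  by_cases h : G.IsEndAt i e
  · have h' : G.IsEndAt i (e.1, !e.2) := h
    rw [eraseGlue_of_isEndAt h, eraseGlue_of_isEndAt h']
    simp
  · have h' : ¬ G.IsEndAt i (G.endGlue σ e) := by rwa [isEndAt_endGlue_iff]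
    rw [eraseGlue_of_not_isEndAt h, eraseGlue_of_not_isEndAt h', endGlue_endGlue]

/-- `restGlue σ i` is an involution. [folklore] -/
@[simp]
theorem restGlue_restGlue (σ : G.State) (i : Fin G.n) (e : Fin (2 * G.n) × Bool) :
    G.restGlue σ i (G.restGlue σ i e) = e := by
  by_cases h : G.IsEndAt i e
  · rw [restGlue_of_isEndAt h, restGlue_of_isEndAt h]
  · have h' : ¬ G.IsEndAt i (G.endGlue σ e) := by rwa [isEndAt_endGlue_iff]
    rw [restGlue_of_not_isEndAt h, restGlue_of_not_isEndAt h', endGlue_endGlue]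

/-- The fixed points of `restGlue σ i` are exactly the ends at chord `i`. [folklore] -/
theorem restGlue_eq_self_iff (σ : G.State) (i : Fin G.n) (e : Fin (2 * G.n) × Bool) :
    G.restGlue σ i e = e ↔ G.IsEndAt i e := by
  refine ⟨fun h ↦ ?_, restGlue_of_isEndAt⟩
  by_contra h'
  rw [restGlue_of_not_isEndAt h'] at h
  exact G.endGlue_ne σ e h

/-- `restGlue σ i` preserves lying at chord `i`. [folklore] -/
theorem isEndAt_restGlue_iff (σ : G.State) (i : Fin G.n) (e : Fin (2 * G.n) × Bool) :
    G.IsEndAt i (G.restGlue σ i e) ↔ G.IsEndAt i e := by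
  by_cases h : G.IsEndAt i e
  · rw [restGlue_of_isEndAt h]
  · rw [restGlue_of_not_isEndAt h, isEndAt_endGlue_iff]

/-- The erased gluing does not see the smoothing chosen at chord `i`. [folklore] -/
theorem eraseGlue_update (σ : G.State) (i : Fin G.n) (b : Bool) :
    G.eraseGlue (Function.update σ i b) i = G.eraseGlue σ i := by
  funext e
  by_cases h : G.IsEndAt i e
  · rw [eraseGlue_of_isEndAt h, eraseGlue_of_isEndAt h]
  · obtain ⟨ho, hu⟩ := not_or.mp h
    rw [eraseGlue_of_not_isEndAt h, eraseGlue_of_not_isEndAt h, G.endGlue_update_of_ne σ b ho hu]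

/-- The rest gluing does not see the smoothing chosen at chord `i`. [folklore] -/
theorem restGlue_update (σ : G.State) (i : Fin G.n) (b : Bool) :
    G.restGlue (Function.update σ i b) i = G.restGlue σ i := by
  funext e
  by_cases h : G.IsEndAt i e
  · rw [restGlue_of_isEndAt h, restGlue_of_isEndAt h]
  · obtain ⟨ho, hu⟩ := not_or.mp h
    rw [restGlue_of_not_isEndAt h, restGlue_of_not_isEndAt h, G.endGlue_update_of_ne σ b ho hu]

/-- The **erased state graph** of `σ` at chord `i`: the simple graph on arcs generated by the
erased gluing `eraseGlue σ i` (two arcs are adjacent if an end of one is glued to an end of the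
other). Its connected components are the circles of the resolution of `σ` at all chords other
than `i`, with the crossing `i` erased (Viro (2004), §5.2). [folklore] -/
def eraseGraph (σ : G.State) (i : Fin G.n) : SimpleGraph G.Arc :=
  SimpleGraph.fromRel fun a b ↦ ∃ e, G.endArc e = a ∧ G.endArc (G.eraseGlue σ i e) = b

/-- Adjacency in the erased state graph is decidable. [folklore] -/
instance (σ : G.State) (i : Fin G.n) : DecidableRel (G.eraseGraph σ i).Adj := fun a b ↦ by
  unfold eraseGraph; infer_instance

/-- The erased state graph does not see the smoothing chosen at chord `i`. [folklore] -/
theorem eraseGraph_update (σ : G.State) (i : Fin G.n) (b : Bool) :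
    G.eraseGraph (Function.update σ i b) i = G.eraseGraph σ i := by
  rw [eraseGraph, eraseGraph, eraseGlue_update]

/-! ## An arc has exactly two ends -/

/-- `arcOut` is injective. [folklore] -/
theorem arcOut_injective : Injective G.arcOut := fun p q h ↦ by
  unfold arcOut at h
  exact Fin.ext (Fin.mk.inj_iff.mp h)

/-- `predPt` is injective. [folklore] -/
theorem predPt_injective : Injective G.predPt := fun p q h ↦ by
  simpa using congrArg G.succPt h

/-- **An arc has exactly its two ends**: `endArc e = endArc e'` iff `e'` is `e` or the other
end `endFlip e` of the same arc. [folklore] -/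
theorem endArc_eq_endArc_iff {e e' : Fin (2 * G.n) × Bool} :
    G.endArc e = G.endArc e' ↔ e' = e ∨ e' = G.endFlip e := by
  constructor
  · intro h
    obtain ⟨p, b⟩ := e
    obtain ⟨q, c⟩ := e'
    cases b <;> cases c <;> simp only [endArc, endFlip, ← arcOut_predPt] at h ⊢
    · left
      rw [G.predPt_injective (G.arcOut_injective h)]
    · right
      rw [G.arcOut_injective h]
    · right
      rw [Prod.mk.injEq]
      refine ⟨?_, rfl⟩
      have := congrArg G.succPt (G.arcOut_injective h)
      simpa using this.symm
    · left
      rw [G.arcOut_injective h]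
  · rintro (rfl | rfl)
    · rfl
    · exact (G.endArc_endFlip e).symm

/-! ## Reachability preserves closed sets of vertices -/

/-- A set of vertices closed under adjacency contains, with a vertex, everything reachable from
it. [folklore] -/
theorem mem_of_reachable {V : Type*} {Γ : SimpleGraph V} {K : Set V}
    (hK : ∀ ⦃a b : V⦄, Γ.Adj a b → a ∈ K → b ∈ K) {a b : V} (h : Γ.Reachable a b) (ha : a ∈ K) :
    b ∈ K := by
  obtain ⟨w⟩ := h
  induction w with
  | nil => exact ha
  | cons hadj _ ih => exact ih (hK hadj ha)

/-- Adjacency in the state graph of `τ` comes from a glued pair of ends. [folklore] -/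
theorem exists_end_of_stateAdj (τ : G.State) {a b : G.Arc} (h : G.stateAdj τ a b) :
    ∃ e, G.endArc e = a ∧ G.endArc (G.endGlue τ e) = b := by
  obtain ⟨-, p, ⟨hs, h⟩ | ⟨hs, h⟩⟩ := h
  · rcases h with ⟨rfl, rfl⟩ | ⟨rfl, rfl⟩
    · exact ⟨(p, false), rfl, by simp [endArc, endGlue, hs]⟩
    · exact ⟨(G.partner p, true), rfl, by simp [endArc, endGlue, hs]⟩
  · rcases h with ⟨rfl, rfl⟩ | ⟨rfl, rfl⟩
    · exact ⟨(p, false), rfl, by simp [endArc, endGlue, hs]⟩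
    · exact ⟨(p, true), rfl, by simp [endArc, endGlue, hs]⟩

/-- Adjacency in the state graph of `τ` comes from a glued pair of ends (symmetrised form).
[folklore] -/
theorem exists_end_of_stateGraph_adj (τ : G.State) {a b : G.Arc} (h : (G.stateGraph τ).Adj a b) :
    ∃ e, G.endArc e = a ∧ G.endArc (G.endGlue τ e) = b := by
  rw [stateGraph, SimpleGraph.fromRel_adj] at h
  obtain ⟨-, h | h⟩ := h
  · exact G.exists_end_of_stateAdj τ h
  · obtain ⟨e, hb, ha⟩ := G.exists_end_of_stateAdj τ h
    exact ⟨G.endGlue τ e, ha, by simpa using hb⟩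

/-- Adjacency in the erased state graph comes from a pair of ends glued by `eraseGlue`.
[folklore] -/
theorem exists_end_of_eraseGraph_adj (σ : G.State) (i : Fin G.n) {a b : G.Arc}
    (h : (G.eraseGraph σ i).Adj a b) :
    ∃ e, G.endArc e = a ∧ G.endArc (G.eraseGlue σ i e) = b := by
  rw [eraseGraph, SimpleGraph.fromRel_adj] at h
  obtain ⟨-, h | ⟨e, hb, ha⟩⟩ := h
  · exact h
  · exact ⟨G.eraseGlue σ i e, ha, by simpa using hb⟩

/-! ## The strand permutation and its orbits -/

/-- `endFlip` (the other end of the same arc) as a permutation of the arc-ends. [folklore] -/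
def endFlipPerm : Equiv.Perm (Fin (2 * G.n) × Bool) :=
  Function.Involutive.toPerm G.endFlip G.endFlip_endFlip

/-- `restGlue σ i` as a permutation of the arc-ends. [folklore] -/
def restGluePerm (σ : G.State) (i : Fin G.n) : Equiv.Perm (Fin (2 * G.n) × Bool) :=
  Function.Involutive.toPerm (G.restGlue σ i) (G.restGlue_restGlue σ i)

/-- The **strand permutation** `ρ = restGlue σ i ∘ endFlip` of the arc-ends: cross the arc, then
follow the gluing (away from chord `i`). Walking along a circle of the erased resolution is
iterating `ρ`; the walk stalls (for one step) exactly at the four ends of chord `i`. [folklore] -/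
def strandPerm (σ : G.State) (i : Fin G.n) : Equiv.Perm (Fin (2 * G.n) × Bool) :=
  G.restGluePerm σ i * G.endFlipPerm

/-- `endFlipPerm` is `endFlip`. [folklore] -/
@[simp]
theorem endFlipPerm_apply (e : Fin (2 * G.n) × Bool) : G.endFlipPerm e = G.endFlip e := rfl

/-- `restGluePerm` is `restGlue`. [folklore] -/
@[simp]
theorem restGluePerm_apply (σ : G.State) (i : Fin G.n) (e : Fin (2 * G.n) × Bool) :
    G.restGluePerm σ i e = G.restGlue σ i e := rfl

/-- `strandPerm` is `restGlue ∘ endFlip`. [folklore] -/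
@[simp]
theorem strandPerm_apply (σ : G.State) (i : Fin G.n) (e : Fin (2 * G.n) × Bool) :
    G.strandPerm σ i e = G.restGlue σ i (G.endFlip e) := rfl

/-- `endFlipPerm` squares to the identity. [folklore] -/
theorem endFlipPerm_mul_self : G.endFlipPerm * G.endFlipPerm = 1 := by
  ext e : 1
  simp [Equiv.Perm.mul_apply]

/-- `restGluePerm` squares to the identity. [folklore] -/
theorem restGluePerm_mul_self (σ : G.State) (i : Fin G.n) :
    G.restGluePerm σ i * G.restGluePerm σ i = 1 := by
  ext e : 1
  simp [Equiv.Perm.mul_apply]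

/-- `endFlipPerm` is its own inverse. [folklore] -/
theorem endFlipPerm_inv : G.endFlipPerm⁻¹ = G.endFlipPerm := by
  rw [inv_eq_iff_mul_eq_one, endFlipPerm_mul_self]

/-- `restGluePerm` is its own inverse. [folklore] -/
theorem restGluePerm_inv (σ : G.State) (i : Fin G.n) :
    (G.restGluePerm σ i)⁻¹ = G.restGluePerm σ i := by
  rw [inv_eq_iff_mul_eq_one, restGluePerm_mul_self]

/-- The inverse of the strand permutation is `endFlip ∘ restGlue`. [folklore] -/
theorem strandPerm_inv (σ : G.State) (i : Fin G.n) :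
    (G.strandPerm σ i)⁻¹ = G.endFlipPerm * G.restGluePerm σ i := by
  rw [strandPerm, mul_inv_rev, endFlipPerm_inv, restGluePerm_inv]

/-- **Dihedral relation**: conjugation by `endFlip` inverts every power of the strand
permutation, `F ρᵏ F = ρ⁻ᵏ`. [folklore] -/
theorem endFlipPerm_mul_zpow_mul_endFlipPerm (σ : G.State) (i : Fin G.n) (k : ℤ) :
    G.endFlipPerm * G.strandPerm σ i ^ k * G.endFlipPerm = G.strandPerm σ i ^ (-k) := by
  have h : G.endFlipPerm * G.strandPerm σ i * G.endFlipPerm⁻¹ = (G.strandPerm σ i)⁻¹ := by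
    rw [endFlipPerm_inv, strandPerm_inv, strandPerm, mul_assoc, mul_assoc, endFlipPerm_mul_self,
      mul_one]
  calc G.endFlipPerm * G.strandPerm σ i ^ k * G.endFlipPerm
      = G.endFlipPerm * G.strandPerm σ i ^ k * G.endFlipPerm⁻¹ := by rw [endFlipPerm_inv]
    _ = (G.endFlipPerm * G.strandPerm σ i * G.endFlipPerm⁻¹) ^ k := conj_zpow.symm
    _ = (G.strandPerm σ i)⁻¹ ^ k := by rw [h]
    _ = G.strandPerm σ i ^ (-k) := inv_zpow' _ _

/-- `F ρᵏ = ρ⁻ᵏ F`. [folklore] -/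
theorem endFlipPerm_mul_zpow (σ : G.State) (i : Fin G.n) (k : ℤ) :
    G.endFlipPerm * G.strandPerm σ i ^ k = G.strandPerm σ i ^ (-k) * G.endFlipPerm := by
  rw [← endFlipPerm_mul_zpow_mul_endFlipPerm, mul_assoc, endFlipPerm_mul_self, mul_one]

variable {G}

section Strand

variable {σ : G.State} {i : Fin G.n} {e₀ : Fin (2 * G.n) × Bool}

/-- For an end `e₀` at chord `i` (a fixed point of the rest gluing), the other end of the arc
of `ρᵏ e₀` is `ρ^(-k-1) e₀`. [folklore] -/
theorem endFlip_zpow_apply (he₀ : G.IsEndAt i e₀) (k : ℤ) :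
    G.endFlip ((G.strandPerm σ i ^ k) e₀) = (G.strandPerm σ i ^ (-k - 1)) e₀ := by
  have h1 : G.endFlip ((G.strandPerm σ i ^ k) e₀) =
      (G.strandPerm σ i ^ (-k)) (G.endFlip e₀) := by
    have := congrArg (fun π : Equiv.Perm (Fin (2 * G.n) × Bool) ↦ π e₀)
      (G.endFlipPerm_mul_zpow σ i k)
    simpa [Equiv.Perm.mul_apply] using this
  have h2 : G.endFlip e₀ = (G.strandPerm σ i)⁻¹ e₀ := by
    rw [strandPerm_inv, Equiv.Perm.mul_apply, restGluePerm_apply, restGlue_of_isEndAt he₀,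
      endFlipPerm_apply]
  rw [h1, h2, ← Equiv.Perm.mul_apply, ← zpow_neg_one, ← zpow_add, sub_eq_add_neg]

/-- For an end `e₀` at chord `i`, the rest gluing maps `ρᵏ e₀` to `ρ⁻ᵏ e₀`. [folklore] -/
theorem restGlue_zpow_apply (he₀ : G.IsEndAt i e₀) (k : ℤ) :
    G.restGlue σ i ((G.strandPerm σ i ^ k) e₀) = (G.strandPerm σ i ^ (-k)) e₀ := by
  have h : G.restGlue σ i ((G.strandPerm σ i ^ k) e₀) =
      G.strandPerm σ i (G.endFlip ((G.strandPerm σ i ^ k) e₀)) := by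
    rw [strandPerm_apply, endFlip_endFlip]
  rw [h, endFlip_zpow_apply he₀, ← Equiv.Perm.mul_apply, ← zpow_one_add]
  congr 2
  ring

variable (G σ i e₀) in
/-- The **strand** of the end `e₀` in the erased resolution of `σ` at chord `i`: the orbit of
`e₀` under the strand permutation `ρ` (all `ρᵏ e₀`, `k ∈ ℤ`). For `e₀` at chord `i` this is the
set of ends of the arcs traversed from `e₀` until chord `i` is reached again. [folklore] -/
def strand : Set (Fin (2 * G.n) × Bool) :=
  {e | ∃ k : ℤ, (G.strandPerm σ i ^ k) e₀ = e}

/-- `e₀` lies on its strand. [folklore] -/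
theorem mem_strand_self : e₀ ∈ G.strand σ i e₀ := ⟨0, by simp⟩

/-- Powers of `ρ` applied to `e₀` lie on the strand. [folklore] -/
theorem zpow_apply_mem_strand (k : ℤ) : (G.strandPerm σ i ^ k) e₀ ∈ G.strand σ i e₀ := ⟨k, rfl⟩

/-- The strand of an end at chord `i` is closed under `endFlip`. [folklore] -/
theorem endFlip_mem_strand (he₀ : G.IsEndAt i e₀) {e : Fin (2 * G.n) × Bool}
    (he : e ∈ G.strand σ i e₀) : G.endFlip e ∈ G.strand σ i e₀ := by
  obtain ⟨k, rfl⟩ := he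
  rw [endFlip_zpow_apply he₀]
  exact zpow_apply_mem_strand _

/-- The strand of an end at chord `i` is closed under the rest gluing. [folklore] -/
theorem restGlue_mem_strand (he₀ : G.IsEndAt i e₀) {e : Fin (2 * G.n) × Bool}
    (he : e ∈ G.strand σ i e₀) : G.restGlue σ i e ∈ G.strand σ i e₀ := by
  obtain ⟨k, rfl⟩ := he
  rw [restGlue_zpow_apply he₀]
  exact zpow_apply_mem_strand _

/-- `ρᵏ e₀ = e₀` iff the period of `e₀` divides `k`. [folklore] -/
theorem zpow_apply_eq_self_iff (k : ℤ) :
    (G.strandPerm σ i ^ k) e₀ = e₀ ↔ (MulAction.period (G.strandPerm σ i) e₀ : ℤ) ∣ k := by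
  rw [← MulAction.zpow_smul_eq_iff_period_dvd, Equiv.Perm.smul_def]

/-- The period of `e₀` under `ρ` is positive (the set of ends is finite). [folklore] -/
theorem period_pos : 0 < MulAction.period (G.strandPerm σ i) e₀ :=
  MulAction.period_pos_of_orderOf_pos (orderOf_pos _) e₀

/-- `ρᵐ e₀ = e₀` for the period `m`. [folklore] -/
theorem zpow_period_apply :
    (G.strandPerm σ i ^ (MulAction.period (G.strandPerm σ i) e₀ : ℤ)) e₀ = e₀ :=
  (zpow_apply_eq_self_iff _).2 dvd_rfl

/-- Shifting the exponent by the period does not change `ρᵏ e₀`. [folklore] -/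
theorem zpow_add_period_apply (k : ℤ) :
    (G.strandPerm σ i ^ (k + MulAction.period (G.strandPerm σ i) e₀)) e₀ =
      (G.strandPerm σ i ^ k) e₀ := by
  rw [zpow_add, Equiv.Perm.mul_apply, zpow_period_apply]

/-- **The period of an end at chord `i` is even**: otherwise the middle end of the strand would
be a fixed point of `endFlip`. [folklore] -/
theorem even_period (he₀ : G.IsEndAt i e₀) : Even (MulAction.period (G.strandPerm σ i) e₀) := by
  by_contra hodd
  rw [Nat.not_even_iff_odd] at hodd
  obtain ⟨k, hk⟩ := hodd
  apply G.endFlip_ne ((G.strandPerm σ i ^ (k : ℤ)) e₀)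
  rw [endFlip_zpow_apply he₀]
  have : (-(k : ℤ) - 1) + MulAction.period (G.strandPerm σ i) e₀ = k := by
    rw [hk]; push_cast; ring
  rw [← zpow_add_period_apply, this]

variable (G σ i e₀) in
/-- The **far end** of the strand of `e₀`: `ρ^(m/2) e₀`, `m` the period of `e₀`. For `e₀` at
chord `i` it is the end at which the walk along the erased resolution starting at `e₀` first
comes back to chord `i`. [folklore] -/
def farEnd : Fin (2 * G.n) × Bool :=
  (G.strandPerm σ i ^ ((MulAction.period (G.strandPerm σ i) e₀ / 2 : ℕ) : ℤ)) e₀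

/-- The far end lies on the strand. [folklore] -/
theorem farEnd_mem_strand : G.farEnd σ i e₀ ∈ G.strand σ i e₀ := zpow_apply_mem_strand _

/-- Twice the half-period is the period (the period being even). [folklore] -/
theorem two_mul_half_period (he₀ : G.IsEndAt i e₀) :
    2 * (MulAction.period (G.strandPerm σ i) e₀ / 2) = MulAction.period (G.strandPerm σ i) e₀ :=
  Nat.two_mul_div_two_of_even (even_period he₀)

/-- The far end of the strand of an end at chord `i` is fixed by the rest gluing. [folklore] -/
theorem restGlue_farEnd (he₀ : G.IsEndAt i e₀) :
    G.restGlue σ i (G.farEnd σ i e₀) = G.farEnd σ i e₀ := by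
  rw [farEnd, restGlue_zpow_apply he₀, ← zpow_add_period_apply]
  congr 2
  have := two_mul_half_period (σ := σ) he₀
  omega

/-- Hence the far end of the strand of an end at chord `i` is an end at chord `i`. [folklore] -/
theorem isEndAt_farEnd (he₀ : G.IsEndAt i e₀) : G.IsEndAt i (G.farEnd σ i e₀) :=
  (G.restGlue_eq_self_iff σ i _).1 (restGlue_farEnd he₀)

/-- The far end is not `e₀` itself (the half-period is a proper divisor of the period).
[folklore] -/
theorem farEnd_ne (he₀ : G.IsEndAt i e₀) : G.farEnd σ i e₀ ≠ e₀ := by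
  have hpos : 0 < MulAction.period (G.strandPerm σ i) e₀ := period_pos
  have h2 := two_mul_half_period (σ := σ) he₀
  have h := MulAction.pow_smul_ne_of_lt_period (m := G.strandPerm σ i) (a := e₀)
    (n := MulAction.period (G.strandPerm σ i) e₀ / 2) (by omega) (by omega)
  rwa [Equiv.Perm.smul_def, ← zpow_natCast] at h

/-- **The ends at chord `i` on the strand of `e₀` are exactly `e₀` and the far end.** If
`ρʲ e₀` is fixed by the rest gluing then `ρ²ʲ e₀ = e₀`, so the half-period divides `j`.
[folklore] -/
theorem eq_self_or_eq_farEnd (he₀ : G.IsEndAt i e₀) {e : Fin (2 * G.n) × Bool}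
    (he : e ∈ G.strand σ i e₀) (hi : G.IsEndAt i e) : e = e₀ ∨ e = G.farEnd σ i e₀ := by
  obtain ⟨j, rfl⟩ := he
  have h2 := two_mul_half_period (σ := σ) he₀
  have h2' : (MulAction.period (G.strandPerm σ i) e₀ : ℤ) =
      2 * ((MulAction.period (G.strandPerm σ i) e₀ / 2 : ℕ) : ℤ) := by
    exact_mod_cast h2.symm
  -- `ρ^(2j) e₀ = e₀`, hence the half-period divides `j`
  have hfix := restGlue_of_isEndAt (σ := σ) hi
  rw [restGlue_zpow_apply he₀] at hfix
  have h2j : (G.strandPerm σ i ^ (j + j)) e₀ = e₀ := by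
    have := congrArg (G.strandPerm σ i ^ j) hfix
    rwa [← Equiv.Perm.mul_apply, ← zpow_add, add_neg_cancel, zpow_zero, Equiv.Perm.one_apply,
      ← Equiv.Perm.mul_apply, ← zpow_add, eq_comm] at this
  rw [zpow_apply_eq_self_iff, h2', ← two_mul] at h2j
  have hdvd : ((MulAction.period (G.strandPerm σ i) e₀ / 2 : ℕ) : ℤ) ∣ j :=
    (mul_dvd_mul_iff_left (two_ne_zero : (2 : ℤ) ≠ 0)).1 h2j
  obtain ⟨q, hq⟩ := hdvd
  rcases Int.even_or_odd' q with ⟨r, rfl | rfl⟩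
  · left
    rw [zpow_apply_eq_self_iff, hq, h2']
    exact ⟨r, by ring⟩
  · right
    have hj : j = ((MulAction.period (G.strandPerm σ i) e₀ / 2 : ℕ) : ℤ) +
        r * (MulAction.period (G.strandPerm σ i) e₀ : ℤ) := by
      rw [hq, h2']; ring
    rw [hj, zpow_add, Equiv.Perm.mul_apply, farEnd]
    congr 1
    rw [zpow_apply_eq_self_iff]
    exact ⟨r, by ring⟩

/-! ## The arcs of a strand -/

variable (G σ i e₀) in
/-- The set of arcs carrying an end of the strand of `e₀` (the arcs traversed by the walk along
the erased resolution from `e₀` to the far end). [folklore] -/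
def strandArcs : Set G.Arc :=
  {a | ∃ e ∈ G.strand σ i e₀, G.endArc e = a}

/-- An arc belongs to the strand iff its ends do. [folklore] -/
theorem endArc_mem_strandArcs_iff (he₀ : G.IsEndAt i e₀) {e : Fin (2 * G.n) × Bool} :
    G.endArc e ∈ G.strandArcs σ i e₀ ↔ e ∈ G.strand σ i e₀ := by
  refine ⟨?_, fun h ↦ ⟨e, h, rfl⟩⟩
  rintro ⟨e₁, he₁, h⟩
  rcases G.endArc_eq_endArc_iff.1 h with rfl | rfl
  · exact he₁
  · exact endFlip_mem_strand he₀ he₁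

/-- **Closure.** If a map `g` of ends preserves the strand, a `g`-gluing step from an arc of the
strand leads to an arc of the strand. [folklore] -/
theorem mem_strandArcs_of_step (he₀ : G.IsEndAt i e₀)
    {g : Fin (2 * G.n) × Bool → Fin (2 * G.n) × Bool}
    (hg : ∀ e ∈ G.strand σ i e₀, g e ∈ G.strand σ i e₀) {a b : G.Arc}
    (ha : a ∈ G.strandArcs σ i e₀) (h : ∃ e, G.endArc e = a ∧ G.endArc (g e) = b) :
    b ∈ G.strandArcs σ i e₀ := by
  obtain ⟨e, rfl, rfl⟩ := h
  rw [endArc_mem_strandArcs_iff he₀] at ha ⊢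
  exact hg e ha

end Strand

/-! ## The trichotomy at a `0`-smoothed chord -/

section Trichotomy

variable {σ : G.State} {i : Fin G.n}

/-- The end `(overPos i, out)` lies at chord `i`. [folklore] -/
theorem isEndAt_overPos_true : G.IsEndAt i (G.overPos i, true) := Or.inl rfl

/-- **Separation in a glued state.** Let `τ` be a state that agrees with `σ` away from chord `i`
and whose gluing at `i` sends the end `e₀ = (overPos i, out)` to the far end of the strand of
`e₀`. Then the arcs of that strand form a union of circles of `τ` containing `arcOut (overPos i)`
but not `arcIn (overPos i)`: the two local strands at chord `i` lie on different circles of `τ`.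
[folklore] -/
theorem circleOf_ne_of_endGlue_eq_farEnd (τ : G.State)
    (hτ : ∀ e, ¬ G.IsEndAt i e → G.endGlue τ e = G.endGlue σ e)
    (he : G.endGlue τ (G.overPos i, true) = G.farEnd σ i (G.overPos i, true)) :
    G.circleOf τ (G.arcIn (G.overPos i)) ≠ G.circleOf τ (G.arcOut (G.overPos i)) := by
  set e₀ : Fin (2 * G.n) × Bool := (G.overPos i, true) with he₀_def
  have he₀ : G.IsEndAt i e₀ := isEndAt_overPos_true
  set K := G.strandArcs σ i e₀ with hK
  -- `K` is closed under the adjacency of the state graph of `τ`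
  have hglue : ∀ e ∈ G.strand σ i e₀, G.endGlue τ e ∈ G.strand σ i e₀ := by
    intro e hs
    by_cases hi : G.IsEndAt i e
    · rcases eq_self_or_eq_farEnd he₀ hs hi with rfl | rfl
      · rw [he]; exact farEnd_mem_strand
      · have : G.endGlue τ (G.farEnd σ i e₀) = e₀ := by
          rw [← he, endGlue_endGlue]
        rw [this]; exact mem_strand_self
    · rw [hτ e hi, ← restGlue_of_not_isEndAt hi]
      exact restGlue_mem_strand he₀ hs
  have hcl : ∀ ⦃a b : G.Arc⦄, (G.stateGraph τ).Adj a b → a ∈ K → b ∈ K := fun a b hab ha ↦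
    mem_strandArcs_of_step he₀ hglue ha (G.exists_end_of_stateGraph_adj τ hab)
  -- `arcOut o ∈ K`, `arcIn o ∉ K`
  have hout : G.arcOut (G.overPos i) ∈ K := ⟨e₀, mem_strand_self, rfl⟩
  have hin : G.arcIn (G.overPos i) ∉ K := by
    intro hmem
    have hmem' : G.endArc (G.overPos i, false) ∈ K := hmem
    rw [hK, endArc_mem_strandArcs_iff he₀] at hmem'
    rcases eq_self_or_eq_farEnd he₀ hmem' (Or.inl rfl) with h | h
    · exact Bool.false_ne_true (congrArg Prod.snd h)
    · -- the far end is the image of `e₀` under a gluing, so its point is `underPos i`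
      have h1 : (G.farEnd σ i e₀).1 = G.underPos i := by
        rw [← he]; simp [endGlue, he₀_def]
      rw [← h] at h1
      exact G.overPos_ne_underPos i i h1
  intro hEq
  rw [circleOf, circleOf, SimpleGraph.ConnectedComponent.eq] at hEq
  exact hin (mem_of_reachable hcl hEq.symm hout)

/-- **The single-circle bifurcation.** If the far end of the strand of `(overPos i, out)` is
`(overPos i, in)` — walking along the erased resolution from the over-passage of chord `i` one
comes back to the over-passage before meeting the under-passage — then the over- and the
under-strand of chord `i` lie on different circles of the erased resolution. (For a diagram in
the plane this is the excluded case: two distinct circles of a planar resolution would cross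
transversally exactly once, at the erased crossing.) Viro (2004), §5.2; Manturov (2007).
[cite: Viro2004, §5.2] -/
theorem not_reachable_eraseGraph_of_farEnd_eq
    (hfar : G.farEnd σ i (G.overPos i, true) = (G.overPos i, false)) :
    ¬ (G.eraseGraph σ i).Reachable (G.arcOut (G.overPos i)) (G.arcOut (G.underPos i)) := by
  set e₀ : Fin (2 * G.n) × Bool := (G.overPos i, true) with he₀_def
  have he₀ : G.IsEndAt i e₀ := isEndAt_overPos_true
  set K := G.strandArcs σ i e₀ with hK
  have hglue : ∀ e ∈ G.strand σ i e₀, G.eraseGlue σ i e ∈ G.strand σ i e₀ := by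
    intro e hs
    by_cases hi : G.IsEndAt i e
    · rw [eraseGlue_of_isEndAt hi]
      rcases eq_self_or_eq_farEnd he₀ hs hi with rfl | rfl
      · change (G.overPos i, false) ∈ G.strand σ i e₀
        rw [← hfar]; exact farEnd_mem_strand
      · rw [hfar]; exact mem_strand_self
    · rw [eraseGlue_of_not_isEndAt hi, ← restGlue_of_not_isEndAt hi]
      exact restGlue_mem_strand he₀ hs
  have hcl : ∀ ⦃a b : G.Arc⦄, (G.eraseGraph σ i).Adj a b → a ∈ K → b ∈ K := fun a b hab ha ↦
    mem_strandArcs_of_step he₀ hglue ha (G.exists_end_of_eraseGraph_adj σ i hab)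
  have hout : G.arcOut (G.overPos i) ∈ K := ⟨e₀, mem_strand_self, rfl⟩
  have hu : G.arcOut (G.underPos i) ∉ K := by
    intro hmem
    have hmem' : G.endArc (G.underPos i, true) ∈ K := hmem
    rw [hK, endArc_mem_strandArcs_iff he₀] at hmem'
    rcases eq_self_or_eq_farEnd he₀ hmem' (Or.inr rfl) with h | h
    · exact G.overPos_ne_underPos i i (congrArg Prod.fst h).symm
    · rw [hfar] at h
      exact G.overPos_ne_underPos i i (congrArg Prod.fst h).symm
  exact fun h ↦ hu (mem_of_reachable hcl h hout)

/-- At a `0`-smoothed chord, flipping the smoothing flips the Seifert rule. [folklore] -/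
theorem isSeifert_update_true (hσ : σ i = false) :
    G.isSeifert (Function.update σ i true) i = !G.isSeifert σ i := by
  unfold isSeifert
  rw [Function.update_self, hσ]
  generalize (G.sign i == 1) = s
  cases s <;> rfl

/-- The gluing of the end `(overPos i, out)` in a state `τ`: `(underPos i, in)` if the smoothing
of `τ` at `i` is Seifert's, `(underPos i, out)` otherwise. [folklore] -/
theorem endGlue_overPos_true (τ : G.State) :
    G.endGlue τ (G.overPos i, true) = (G.underPos i, !G.isSeifert τ i) := by
  cases h : G.isSeifert τ i <;> simp [endGlue, h]

/-- **Merge-or-split from the erased resolution** (combinatorial half of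
`isMergeAt_or_isSplitAt_of_hasGaussDiagram`). Let `σ` take the `0`-smoothing at chord `i`, and
suppose that in the resolution of `σ` at all other chords, with the crossing `i` erased, the
over-strand and the under-strand of chord `i` lie on the same circle. Then the flip `0 → 1` at
`i` is a merge or a split. Indeed the walk along that circle from the over-passage first returns
to chord `i` at the under-passage, either against the orientation (`farEnd = (underPos i, in)`:
the Seifert smoothing at `i` separates the two local strands) or along it
(`farEnd = (underPos i, out)`: the other smoothing does), and exactly one of `σ`, `σ[i ↦ 1]`
takes the Seifert smoothing at `i`. This is the diagrammatic content of Viro (2004), §5.2,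
p. 330 ("a single Morse modification of index 1 … either joining two circles or splitting a
circle"); what planarity adds is that the hypothesis always holds. [cite: Viro2004, §5.2] -/
theorem isMergeAt_or_isSplitAt_of_reachable_eraseGraph (hσ : σ i = false)
    (h : (G.eraseGraph σ i).Reachable (G.arcOut (G.overPos i)) (G.arcOut (G.underPos i))) :
    G.IsMergeAt σ i ∨ G.IsSplitAt σ i := by
  have he₀ : G.IsEndAt i (G.overPos i, true) := isEndAt_overPos_true
  have hfar : G.IsEndAt i (G.farEnd σ i (G.overPos i, true)) := isEndAt_farEnd he₀
  have hne : G.farEnd σ i (G.overPos i, true) ≠ (G.overPos i, true) := farEnd_ne he₀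
  have hne' : G.farEnd σ i (G.overPos i, true) ≠ (G.overPos i, false) := fun hf ↦
    not_reachable_eraseGraph_of_farEnd_eq hf h
  -- so the far end is `(underPos i, b)` for some `b`
  obtain ⟨b, hb⟩ : ∃ b, G.farEnd σ i (G.overPos i, true) = (G.underPos i, b) := by
    rcases hf : G.farEnd σ i (G.overPos i, true) with ⟨q, b⟩
    rw [hf] at hfar hne hne'
    rcases hfar with hq | hq <;> simp only at hq <;> subst hq
    · cases b
      · exact (hne' rfl).elim
      · exact (hne rfl).elim
    · exact ⟨b, rfl⟩
  have hτσ : ∀ e, ¬ G.IsEndAt i e → G.endGlue σ e = G.endGlue σ e := fun _ _ ↦ rfl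
  have hτσ' : ∀ e, ¬ G.IsEndAt i e →
      G.endGlue (Function.update σ i true) e = G.endGlue σ e := fun e he ↦ by
    obtain ⟨ho, hu⟩ := not_or.mp he
    exact G.endGlue_update_of_ne σ true ho hu
  have hS' : G.isSeifert (Function.update σ i true) i = !G.isSeifert σ i :=
    isSeifert_update_true hσ
  -- the state (among `σ`, `σ[i ↦ 1]`) whose gluing at `i` sends `(overPos i, out)` to the far
  -- end separates the two local strands
  cases hS : G.isSeifert σ i <;> cases b
  · -- non-Seifert at `i` in `σ`, far end `(u, in)`: `σ[i ↦ 1]` is Seifert at `i` — a split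
    right
    refine ⟨hσ, circleOf_ne_of_endGlue_eq_farEnd (Function.update σ i true) hτσ' ?_⟩
    simp only [endGlue_overPos_true, hS', hS, hb, Bool.not_false, Bool.not_true]
  · -- non-Seifert at `i` in `σ`, far end `(u, out)`: `σ` — a merge
    left
    refine ⟨hσ, circleOf_ne_of_endGlue_eq_farEnd σ hτσ ?_⟩
    simp only [endGlue_overPos_true, hS, hb, Bool.not_false]
  · -- Seifert at `i` in `σ`, far end `(u, in)`: `σ` — a merge
    left
    refine ⟨hσ, circleOf_ne_of_endGlue_eq_farEnd σ hτσ ?_⟩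
    simp only [endGlue_overPos_true, hS, hb, Bool.not_true]
  · -- Seifert at `i` in `σ`, far end `(u, out)`: `σ[i ↦ 1]` — a split
    right
    refine ⟨hσ, circleOf_ne_of_endGlue_eq_farEnd (Function.update σ i true) hτσ' ?_⟩
    simp only [endGlue_overPos_true, hS', hS, hb, Bool.not_false, Bool.not_true]

/-! ## The converse: a merge or a split joins the two passages in the erased resolution -/

/-- Adjacent-or-equal arcs glued by `eraseGlue` are reachable in the erased state graph.
[folklore] -/
theorem reachable_endArc_eraseGlue (σ : G.State) (i : Fin G.n) (e : Fin (2 * G.n) × Bool) :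
    (G.eraseGraph σ i).Reachable (G.endArc e) (G.endArc (G.eraseGlue σ i e)) := by
  by_cases heq : G.endArc e = G.endArc (G.eraseGlue σ i e)
  · rw [← heq]
  · refine SimpleGraph.Adj.reachable ?_
    rw [eraseGraph, SimpleGraph.fromRel_adj]
    exact ⟨heq, Or.inl ⟨e, rfl, rfl⟩⟩

/-- **Walking along the strand.** In any graph on arcs in which every gluing step of `σ` away
from chord `i` is a reachability, the arc of `ρᵏ e₀` is reachable from the arc of `e₀` for every
`k : ℕ` (each step of `ρ` crosses an arc and then either glues away from chord `i` or stalls at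
an end of chord `i`). [folklore] -/
theorem reachable_endArc_pow_apply (Γ : SimpleGraph G.Arc)
    (hΓ : ∀ e, ¬ G.IsEndAt i e → Γ.Reachable (G.endArc e) (G.endArc (G.endGlue σ e)))
    (e₀ : Fin (2 * G.n) × Bool) (k : ℕ) :
    Γ.Reachable (G.endArc e₀) (G.endArc ((G.strandPerm σ i ^ k) e₀)) := by
  induction k with
  | zero => simp
  | succ k ih =>
    rw [pow_succ', Equiv.Perm.mul_apply, strandPerm_apply]
    have h1 : G.endArc (G.endFlip ((G.strandPerm σ i ^ k) e₀)) =
        G.endArc ((G.strandPerm σ i ^ k) e₀) := G.endArc_endFlip _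
    by_cases he : G.IsEndAt i (G.endFlip ((G.strandPerm σ i ^ k) e₀))
    · rw [restGlue_of_isEndAt he, h1]
      exact ih
    · rw [restGlue_of_not_isEndAt he]
      rw [← h1] at ih
      exact ih.trans (hΓ _ he)

/-- The far end as a natural power of `ρ` applied to `e₀`. [folklore] -/
theorem farEnd_eq_pow_apply (e₀ : Fin (2 * G.n) × Bool) :
    G.farEnd σ i e₀ =
      (G.strandPerm σ i ^ (MulAction.period (G.strandPerm σ i) e₀ / 2)) e₀ := by
  rw [farEnd, zpow_natCast]

/-- In a state `τ` agreeing with `σ` away from chord `i`, the arc of the far end of the strand of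
`e₀` lies on the state circle of the arc of `e₀`. [folklore] -/
theorem reachable_stateGraph_endArc_farEnd (τ : G.State)
    (hτ : ∀ e, ¬ G.IsEndAt i e → G.endGlue τ e = G.endGlue σ e) (e₀ : Fin (2 * G.n) × Bool) :
    (G.stateGraph τ).Reachable (G.endArc e₀) (G.endArc (G.farEnd σ i e₀)) := by
  rw [farEnd_eq_pow_apply]
  refine reachable_endArc_pow_apply _ (fun e he ↦ ?_) e₀ _
  rw [← hτ e he]
  exact G.reachable_endArc_endGlue τ e

/-- The arc of the far end of the strand of `e₀` lies on the circle of the arc of `e₀` in the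
erased resolution. [folklore] -/
theorem reachable_eraseGraph_endArc_farEnd (e₀ : Fin (2 * G.n) × Bool) :
    (G.eraseGraph σ i).Reachable (G.endArc e₀) (G.endArc (G.farEnd σ i e₀)) := by
  rw [farEnd_eq_pow_apply]
  refine reachable_endArc_pow_apply _ (fun e he ↦ ?_) e₀ _
  rw [← eraseGlue_of_not_isEndAt he]
  exact G.reachable_endArc_eraseGlue σ i e

/-- **Converse: a merge or a split joins the two passages in the erased resolution.** If the flip
at the `0`-smoothed chord `i` is a merge or a split, then the far end of the strand of
`(overPos i, out)` is not `(overPos i, in)` (that would put `arcIn (overPos i)` on the circle of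
`arcOut (overPos i)` both in `σ` and in `σ[i ↦ 1]`), hence it is an end at `underPos i`, and the
walk along the strand connects the over-strand to the under-strand of chord `i` in the erased
resolution. Viro (2004), §5.2. [cite: Viro2004, §5.2] -/
theorem reachable_eraseGraph_of_isMergeAt_or_isSplitAt (h : G.IsMergeAt σ i ∨ G.IsSplitAt σ i) :
    (G.eraseGraph σ i).Reachable (G.arcOut (G.overPos i)) (G.arcOut (G.underPos i)) := by
  have he₀ : G.IsEndAt i (G.overPos i, true) := isEndAt_overPos_true
  have hfar : G.IsEndAt i (G.farEnd σ i (G.overPos i, true)) := isEndAt_farEnd he₀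
  have hne : G.farEnd σ i (G.overPos i, true) ≠ (G.overPos i, true) := farEnd_ne he₀
  have hτσ' : ∀ e, ¬ G.IsEndAt i e →
      G.endGlue (Function.update σ i true) e = G.endGlue σ e := fun e he ↦ by
    obtain ⟨ho, hu⟩ := not_or.mp he
    exact G.endGlue_update_of_ne σ true ho hu
  -- the far end is not `(overPos i, in)`: that is the single-circle bifurcation
  have hne' : G.farEnd σ i (G.overPos i, true) ≠ (G.overPos i, false) := by
    intro hf
    rcases h with ⟨-, h⟩ | ⟨-, h⟩
    · apply h
      rw [circleOf, circleOf, SimpleGraph.ConnectedComponent.eq]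
      have := reachable_stateGraph_endArc_farEnd (σ := σ) (i := i) σ (fun _ _ ↦ rfl)
        (G.overPos i, true)
      rw [hf] at this
      exact this.symm
    · apply h
      rw [circleOf, circleOf, SimpleGraph.ConnectedComponent.eq]
      have := reachable_stateGraph_endArc_farEnd (σ := σ) (i := i) (Function.update σ i true)
        hτσ' (G.overPos i, true)
      rw [hf] at this
      exact this.symm
  -- so it is `(underPos i, b)`, and the walk along the strand reaches it
  have hreach := reachable_eraseGraph_endArc_farEnd (σ := σ) (i := i) (G.overPos i, true)
  rcases hf : G.farEnd σ i (G.overPos i, true) with ⟨q, b⟩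
  rw [hf] at hfar hne hne' hreach
  rcases hfar with hq | hq <;> simp only at hq <;> subst hq
  · cases b
    · exact (hne' rfl).elim
    · exact (hne rfl).elim
  · cases b
    · have h2 := G.reachable_endArc_eraseGlue σ i (G.underPos i, false)
      rw [eraseGlue_of_isEndAt (Or.inr rfl)] at h2
      exact hreach.trans h2
    · exact hreach

/-- **The trichotomy as a criterion.** At a `0`-smoothed chord `i`, the flip `0 → 1` is a merge
or a split iff the over-strand and the under-strand of chord `i` lie on one circle of the
resolution of `σ` with the crossing `i` erased; the remaining case is the single-circle
bifurcation. Viro (2004), §5.2; Manturov (2007). [cite: Viro2004, §5.2] -/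
theorem isMergeAt_or_isSplitAt_iff_reachable_eraseGraph (hσ : σ i = false) :
    (G.IsMergeAt σ i ∨ G.IsSplitAt σ i) ↔
      (G.eraseGraph σ i).Reachable (G.arcOut (G.overPos i)) (G.arcOut (G.underPos i)) :=
  ⟨reachable_eraseGraph_of_isMergeAt_or_isSplitAt, isMergeAt_or_isSplitAt_of_reachable_eraseGraph hσ⟩

end Trichotomy

end GaussDiagram

end Literature.Topology.FourManifolds
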